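import Literature.NumberTheory.CubicFields.CubicFieldCountForms
import Literature.NumberTheory.CubicFields.ReducibleMaximalCount
import Mathlib.Data.Set.Card
import HarnessLib

/-!
# Maximal cubic rings of bounded discriminant = cubic fields + quadratic fields (+ `ℚ³`)

Topic `Literature/NumberTheory/CubicFields`; the junction of `CubicFieldCountForms.lean`
(`N₃^±(X) = #` Davenport–Heilbronn orbits) and `ReducibleMaximalCount.lean` (maximal reducible
orbits are counted by the fundamental discriminants, i.e. by `N₂^±(X)`, plus `ℤ³`).

Bhargava–Taniguchi–Thorne 2023, §4.1: "Except for `ℚ³`, reducible cubic étale algebras take the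
form `F × ℚ` where `F` is a quadratic field", cubic étale algebras being in bijection with their
maximal orders (§2.1); so the maximal cubic rings with `0 < ±Disc < X` are: the maximal orders of the
cubic fields (`N₃^±(X)` of them up to isomorphism), the rings `ℤ × 𝓞_F` for the quadratic fields `F`
with `0 < ±d_F < X` (`N₂^±(X)` of them), and `ℤ³` (`Disc = 1`). On the side of forms:

* `maximalOrbitsIn s X` — the `GL₂(ℤ)`-orbits of maximal forms `g` with `0 < s · Disc g < X`;
* `maximalOrbitsIn_eq_union`, `disjoint_dhOrbits_reducible` — they are the disjoint union of the
  Davenport–Heilbronn orbits `dhOrbits s X` and the maximal reducible orbits;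
* **`card_maximalOrbitsIn_neg`**: `#{maximal orbits, −X < Disc < 0} = N₃⁻(X) + N₂⁻(X)`;
* **`card_maximalOrbitsIn_pos`**: `#{maximal orbits, 0 < Disc < X} = N₃⁺(X) + N₂⁺(X) + [1 < X]`,
  where `N₂^±(X) = #negFundDiscrs X`, `#posFundDiscrs X` (the quadratic side, `ThreeTorsionMean.lean`).

## References

* M. Bhargava, T. Taniguchi, F. Thorne, *Improved error estimates for the Davenport–Heilbronn
  theorems*, Math. Ann. 389 (2024) = arXiv:2107.12819, §2.1, §4.1 [BhargavaTaniguchiThorne2023].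
-/

namespace Literature.NumberTheory.CubicFields

open BinaryCubic RingOfForm Literature.NumberTheory.QuadraticFields

/-- The `GL₂(ℤ)`-orbits of maximal integral binary cubic forms with `0 < s · Disc < X` (the maximal
cubic rings = maximal orders of cubic étale algebras with `0 < ±Disc < X`, BTT §2.1/§4.1). [cite: BhargavaTaniguchiThorne2023, §4.1 (maximal cubic rings: cubic fields, F₂ × ℚ, ℚ³)] -/
def maximalOrbitsIn (s : ℤ) (X : ℕ) : Set (Set (BinaryCubic ℤ)) :=
  {O | ∃ g : BinaryCubic ℤ, O = gl2zOrbit g ∧ IsMaximal g ∧ 0 < s * g.disc ∧ s * g.disc < X}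

/-- The maximal reducible orbits with `0 < s · Disc < X`, `s = ±1`, in the spelling of
`ReducibleMaximalCount.lean`. [folklore] -/
def reducibleMaximalOrbitsIn (s : ℤ) (X : ℕ) : Set (Set (BinaryCubic ℤ)) :=
  {O | ∃ g : BinaryCubic ℤ, O = gl2zOrbit g ∧ IsMaximal g ∧ ¬ g.IsIrreducible ∧ 0 < s * g.disc ∧ s * g.disc < X}

/-- For `s = −1` these are `negReducibleMaximalOrbits X`. [folklore] -/
theorem reducibleMaximalOrbitsIn_neg (X : ℕ) : reducibleMaximalOrbitsIn (-1) X = negReducibleMaximalOrbits X := by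
  ext O
  constructor
  · rintro ⟨g, rfl, hmax, hred, hlo, hhi⟩
    exact ⟨g, rfl, hmax, hred, by linarith, by linarith⟩
  · rintro ⟨g, rfl, hmax, hred, hlo, hhi⟩
    exact ⟨g, rfl, hmax, hred, by linarith, by linarith⟩

/-- For `s = 1` these are `posReducibleMaximalOrbits X`. [folklore] -/
theorem reducibleMaximalOrbitsIn_pos (X : ℕ) : reducibleMaximalOrbitsIn 1 X = posReducibleMaximalOrbits X := by
  ext O
  constructor
  · rintro ⟨g, rfl, hmax, hred, hlo, hhi⟩
    exact ⟨g, rfl, hmax, hred, by linarith, by linarith⟩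
  · rintro ⟨g, rfl, hmax, hred, hlo, hhi⟩
    exact ⟨g, rfl, hmax, hred, by linarith, by linarith⟩

/-- **Maximal orbits = Davenport–Heilbronn orbits ∪ maximal reducible orbits** (a maximal
irreducible form lies in every `U_p`, Prop. 2.2; conversely a DH orbit consists of maximal forms). [folklore] -/
theorem maximalOrbitsIn_eq_union (s : ℤ) (X : ℕ) :
    maximalOrbitsIn s X = dhOrbits s (X : ℝ) ∪ reducibleMaximalOrbitsIn s X := by
  ext O
  constructor
  · rintro ⟨g, rfl, hmax, hlo, hhi⟩
    by_cases hirr : g.IsIrreducible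
    · left
      exact ⟨g, rfl, hirr, isMaximal_iff_memU.mp hmax, hlo, by exact_mod_cast hhi⟩
    · right
      exact ⟨g, rfl, hmax, hirr, hlo, hhi⟩
  · rintro (⟨g, rfl, -, hU, hlo, hhi⟩ | ⟨g, rfl, hmax, -, hlo, hhi⟩)
    · exact ⟨g, rfl, isMaximal_iff_memU.mpr hU, hlo, by exact_mod_cast hhi⟩
    · exact ⟨g, rfl, hmax, hlo, hhi⟩

/-- The two pieces are disjoint (irreducibility is an invariant of the orbit). [folklore] -/
theorem disjoint_dhOrbits_reducible (s : ℤ) (X : ℕ) :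
    Disjoint (dhOrbits s (X : ℝ)) (reducibleMaximalOrbitsIn s X) := by
  rw [Set.disjoint_left]
  rintro O ⟨f, rfl, hirr, -, -, -⟩ ⟨g, hO, -, hred, -, -⟩
  exact hred ((gl2zOrbit_eq_iff.mp hO).isIrreducible_iff.mp hirr)

/-- The set of maximal reducible orbits in a window is finite. [folklore] -/
theorem reducibleMaximalOrbitsIn_finite (s : ℤ) [hs : Fact (s = 1 ∨ s = -1)] (X : ℕ) :
    (reducibleMaximalOrbitsIn s X).Finite := by
  rcases hs.out with rfl | rfl
  · rw [reducibleMaximalOrbitsIn_pos]; exact posReducibleMaximalOrbits_finite X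
  · rw [reducibleMaximalOrbitsIn_neg]; exact negReducibleMaximalOrbits_finite X

/-- **`#{maximal orbits, 0 < s·Disc < X} = N₃^s(X) + #{maximal reducible orbits in the window}`.** [folklore] -/
theorem card_maximalOrbitsIn (s : ℤ) [Fact (s = 1 ∨ s = -1)] (X : ℕ) :
    Nat.card (maximalOrbitsIn s X) = cubicFieldCount s (X : ℝ) + Nat.card (reducibleMaximalOrbitsIn s X) := by
  rw [cubicFieldCount_eq_card_dhOrbits, Nat.card_coe_set_eq, Nat.card_coe_set_eq, Nat.card_coe_set_eq,
    maximalOrbitsIn_eq_union,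
    Set.ncard_union_eq (disjoint_dhOrbits_reducible s X) (dhOrbits_finite s X) (reducibleMaximalOrbitsIn_finite s X)]

/-- **Maximal cubic rings with `−X < Disc < 0`: `N₃⁻(X) + N₂⁻(X)`** (cubic fields and `ℤ × 𝓞_F`,
`F` imaginary quadratic; BTT §4.1). [cite: BhargavaTaniguchiThorne2023, §4.1 (maximal cubic rings = maximal orders of cubic fields, of F₂ × ℚ, and ℤ³)] -/
theorem card_maximalOrbitsIn_neg (X : ℕ) :
    Nat.card (maximalOrbitsIn (-1) X) = cubicFieldCount (-1) (X : ℝ) + (negFundDiscrs X).card := by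
  haveI : Fact ((-1 : ℤ) = 1 ∨ (-1 : ℤ) = -1) := ⟨Or.inr rfl⟩
  rw [card_maximalOrbitsIn, reducibleMaximalOrbitsIn_neg, card_negReducibleMaximalOrbits]

/-- **Maximal cubic rings with `0 < Disc < X`: `N₃⁺(X) + N₂⁺(X) + [1 < X]`** (cubic fields,
`ℤ × 𝓞_F` for `F` real quadratic, and `ℤ³` of discriminant `1`; BTT §4.1). [cite: BhargavaTaniguchiThorne2023, §4.1 (maximal cubic rings = maximal orders of cubic fields, of F₂ × ℚ, and ℤ³)] -/
theorem card_maximalOrbitsIn_pos (X : ℕ) :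
    Nat.card (maximalOrbitsIn 1 X) = cubicFieldCount 1 (X : ℝ) + (posFundDiscrs X).card + (if 1 < X then 1 else 0) := by
  haveI : Fact ((1 : ℤ) = 1 ∨ (1 : ℤ) = -1) := ⟨Or.inl rfl⟩
  rw [card_maximalOrbitsIn, reducibleMaximalOrbitsIn_pos, card_posReducibleMaximalOrbits, add_assoc]

/-- The set of maximal orbits in a window is finite (so the counts above are honest). [folklore] -/
theorem maximalOrbitsIn_finite (s : ℤ) [Fact (s = 1 ∨ s = -1)] (X : ℕ) : (maximalOrbitsIn s X).Finite := by
  rw [maximalOrbitsIn_eq_union]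
  exact (dhOrbits_finite s X).union (reducibleMaximalOrbitsIn_finite s X)

end Literature.NumberTheory.CubicFields
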